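/-
Copyright (c) 2026 the pub-hodgecm-mathlib formalisation cell (harness21).  Prover seat hodgecm-mathlib-K2E3-p21 (g4), Track B «K2-LIT» ∕ h413
(`stmt-HodgeConjecture-24833`), line `K2_E3_EllipticInputs`, unit U12 §L, kernel road «RICHARDSON» for (L-B_GL) at `N = 3` (road owner K2E3-p11 (g4), deal
2026-09-04T04:32Z «Λ_E PACKAGING»), brick (R2-pack), part 2: THE MINIMAL-ORBIT RICHARDSON MEASURE ON `𝔤𝔩₃(F)` AND ITS DOCK ON `↥(Ad·E₁₃)`.  2026-09-04.
-/
import Summits.HodgeConjecture.HodgeConjecture.Theorems.K2E3GLnRichardsonMeasureRadon    -- (R2-pack) part 1 (this seat): `Λ_c` Radon, `≠ 0`, `Ad`-invariant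
import Summits.HodgeConjecture.HodgeConjecture.Theorems.K2E3GL3NilpotentStructureOfOrbitMeasures  -- ★ (R1d) p857363 (K2E3-p20 g5): structure over hypothesised orbit measures (brings ★ R1a∕R1b∕R1c)
import HarnessLib

/-!
# K2_E3 road (h413), §L — kernel road «RICHARDSON» for (L-B_GL) at `N = 3`, brick (R2-pack) part 2: on `𝔤𝔩₃(F)` the Richardson measure `Λ_c` of a
# two-block parabolic is carried by the minimal nilpotent orbit `Ad·E₁₃`; (R1d) with `Λ_E` discharged

Cell `pub/hodgecm-mathlib` (D-0151), Track B, seat K2E3-p21 (g4); road owner K2E3-p11 (g4) (2026-09-04T04:32Z), §L lead K2E3-p12 (g4), dealer K2E3-plan (g3).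
`--supports stmt-HodgeConjecture-24833 --as helper`; THEOREMS ONLY (no definition ∕ instance ∕ notation ∕ named fact ∕ `sorry`); never imports `Cruxes/…/Lines`.
COUNT-NEUTRAL ((L-B_GL) ∕ (LBGL-ge3) stay OPEN).

`ρ := κ.prod μN` on `GL₃(𝒪) × U_c`, `φ(k, u) := k (u − 1) k⁻¹`, `Λ_c := ρ.map φ` (written out in full), `c : Fin 3 → Bool` a two-block labelling with non-empty box.
* §3 `φ(k, u)` is `0` (`u = 1`) or a square-zero non-zero matrix, i.e. a point of `Ad·E₁₃` (★ R1a `mem_orbit_nilpMin_iff`, ★ p857353 `sub_one_mul_sub_one_eq_zero`), so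
  **`Λ_c((Ad·E₁₃)ᶜ) = 0`** (★ part 1 `μ_U {1} = 0`) and `Λ_c(Ad·E₁₃) ≠ 0`;
* §4 **(R1d) MODULO Λ_J**: plugging `Λ_E := Λ_c` into ★ (R1d) `gl3_nilpotentStructure_of_orbitMeasures` (K2E3-p20 (g5)) — every `T ∈ J(𝒩)(𝔤𝔩₃(F))` is
  `a·δ₀ + b·∫_{GL₃(𝒪)×U_c} f(k(u−1)k⁻¹) + c′·Λ_J`, with only the REGULAR-orbit measure `Λ_J` ((R2-Borel)) left as a hypothesis.
[HarishChandra1999AdmissibleDistributions, §3 pp. 8–10]; [RangaRao1972]; [BernsteinZelevinsky1976, §1.18].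

HONEST LABEL: HC_CM is proved only modulo the 7 printed citations (2 remaining named inputs: hLiu418 = stmt-HodgeConjecture-24832, h413 = stmt-HodgeConjecture-24833)
until rung 0 closes; count-neutral helper.

References: [HarishChandra1999AdmissibleDistributions] Harish-Chandra (DeBacker–Sally), AMS ULECT 16 (1999), §3 pp. 8–10 · [RangaRao1972] R. Ranga Rao, Ann. of
Math. 96 (1972) 505–510 · [BernsteinZelevinsky1976] Russian Math. Surveys 31:3 (1976), §1.18.
-/

set_option autoImplicit false
set_option linter.dupNamespace false   -- `Summit.HodgeConjecture.HodgeConjecture.…` (D-0017 nested layout; lakefile exemption for Summits)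

noncomputable section

open MeasureTheory Measure Filter Topology TopologicalSpace Set
open scoped MatrixGroups NNReal ENNReal
open Literature.NumberTheory.Rogawski1990 Literature.NumberTheory.Automorphic
open Literature.NumberTheory.GaloisRepresentations Literature.NumberTheory.GaloisRepresentations.IsNonarchimedeanLocalField
open Summit.HodgeConjecture.HodgeConjecture.Cruxes.H413.K2E3GL3NilpotentOrbits
open Summit.HodgeConjecture.HodgeConjecture.Cruxes.H413.K2E3GL3NilpotentOrbitSpaces
open Summit.HodgeConjecture.HodgeConjecture.Cruxes.H413.K2E3GLnRichardsonLieMeasureAdInvariant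
open Summit.HodgeConjecture.HodgeConjecture.Cruxes.H413.K2E3GLnRichardsonMeasureRadon

namespace Summit.HodgeConjecture.HodgeConjecture.Cruxes.H413.K2E3GL3MinimalRichardsonMeasure

/-! ## §3  `n = 3`: `Λ_c` is carried by the minimal orbit `Ad·E₁₃` -/

section Three

variable {F : Type*} [Field F] [ValuativeRel F] [TopologicalSpace F] [IsNonarchimedeanLocalField F] {c : Fin 3 → Bool}
  [MeasurableSpace (GL (Fin 3) F)] [BorelSpace (GL (Fin 3) F)] [MeasurableSpace (Matrix (Fin 3) (Fin 3) F)] [BorelSpace (Matrix (Fin 3) (Fin 3) F)]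
  (κ : Measure ↥(glInt 3 F)) (μN : Measure ↥(unipotentRadicalGL F c))

omit [TopologicalSpace F] [IsNonarchimedeanLocalField F] [MeasurableSpace (GL (Fin 3) F)] [BorelSpace (GL (Fin 3) F)]
  [MeasurableSpace (Matrix (Fin 3) (Fin 3) F)] [BorelSpace (Matrix (Fin 3) (Fin 3) F)] in
/-- For a two-block `c` every `φ(k, u) = k (u − 1) k⁻¹` with `u ≠ 1` lies on the minimal orbit `Ad·E₁₃` (`(u − 1)² = 0`, `u − 1 ≠ 0`).
[cite: HarishChandra1999AdmissibleDistributions, §3 p. 9] -/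
theorem richardsonMap_mem_orbit_nilpMin_of_ne_one (q : ↥(glInt 3 F) × ↥(unipotentRadicalGL F c)) (hq : q.2 ≠ 1) :
    (((q.1 : GL (Fin 3) F)) : Matrix (Fin 3) (Fin 3) F) * ((((q.2 : GL (Fin 3) F)) : Matrix (Fin 3) (Fin 3) F) - 1) *
        ((((q.1 : GL (Fin 3) F))⁻¹ : GL (Fin 3) F) : Matrix (Fin 3) (Fin 3) F) ∈
      MulAction.orbit (ConjAct (GL (Fin 3) F)) (!![0, 0, 1; 0, 0, 0; 0, 0, 0] : Matrix (Fin 3) (Fin 3) F) := by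
  rw [mem_orbit_nilpMin_iff, conj_mul_conj_eq_zero_iff]
  refine ⟨sub_one_mul_sub_one_eq_zero q.2.2 q.2.2, conj_ne_zero _ fun h => hq ?_⟩
  exact Subtype.ext (Units.ext (sub_eq_zero.1 h))

/-- **`Λ_c((Ad·E₁₃)ᶜ) = 0`** for a two-block `c` with non-empty box: the only values of `φ` off the minimal orbit come from `u = 1`, and `μ_U {1} = 0`.
[cite: HarishChandra1999AdmissibleDistributions, §3 p. 9] -/
theorem map_richardson_apply_compl_orbit_nilpMin (hIJ : ∃ i j : Fin 3, c i = false ∧ c j = true) [SFinite κ] [IsHaarMeasure μN] :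
    ((κ.prod μN).map fun q : ↥(glInt 3 F) × ↥(unipotentRadicalGL F c) =>
      (((q.1 : GL (Fin 3) F)) : Matrix (Fin 3) (Fin 3) F) * ((((q.2 : GL (Fin 3) F)) : Matrix (Fin 3) (Fin 3) F) - 1) *
        ((((q.1 : GL (Fin 3) F))⁻¹ : GL (Fin 3) F) : Matrix (Fin 3) (Fin 3) F))
      (MulAction.orbit (ConjAct (GL (Fin 3) F)) (!![0, 0, 1; 0, 0, 0; 0, 0, 0] : Matrix (Fin 3) (Fin 3) F))ᶜ = 0 := by
  haveI : T2Space F := (isLocalField F).toT2Space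
  rw [Measure.map_apply (measurable_richardsonMap (F := F) (c := c)) (measurableSet_orbit_nilpMin (F := F)).compl]
  have hsub : (fun q : ↥(glInt 3 F) × ↥(unipotentRadicalGL F c) =>
      (((q.1 : GL (Fin 3) F)) : Matrix (Fin 3) (Fin 3) F) * ((((q.2 : GL (Fin 3) F)) : Matrix (Fin 3) (Fin 3) F) - 1) *
        ((((q.1 : GL (Fin 3) F))⁻¹ : GL (Fin 3) F) : Matrix (Fin 3) (Fin 3) F)) ⁻¹'
      (MulAction.orbit (ConjAct (GL (Fin 3) F)) (!![0, 0, 1; 0, 0, 0; 0, 0, 0] : Matrix (Fin 3) (Fin 3) F))ᶜ ⊆ Set.univ ×ˢ {1} := by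
    intro q hq
    refine ⟨Set.mem_univ _, ?_⟩
    by_contra h1
    exact hq (richardsonMap_mem_orbit_nilpMin_of_ne_one q h1)
  haveI := sFinite_haar_unipotentRadicalGL (F := F) μN
  refine measure_mono_null hsub ?_
  rw [Measure.prod_prod, haar_unipotentRadicalGL_singleton_one hIJ μN, mul_zero]

/-- **`Λ_c(Ad·E₁₃) ≠ 0`** (= `Λ_c(𝔤𝔩₃) ≠ 0`). [cite: HarishChandra1999AdmissibleDistributions, §3 p. 9] -/
theorem map_richardson_apply_orbit_nilpMin_ne_zero (hIJ : ∃ i j : Fin 3, c i = false ∧ c j = true) [IsHaarMeasure κ] [IsHaarMeasure μN] :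
    ((κ.prod μN).map fun q : ↥(glInt 3 F) × ↥(unipotentRadicalGL F c) =>
      (((q.1 : GL (Fin 3) F)) : Matrix (Fin 3) (Fin 3) F) * ((((q.2 : GL (Fin 3) F)) : Matrix (Fin 3) (Fin 3) F) - 1) *
        ((((q.1 : GL (Fin 3) F))⁻¹ : GL (Fin 3) F) : Matrix (Fin 3) (Fin 3) F))
      (MulAction.orbit (ConjAct (GL (Fin 3) F)) (!![0, 0, 1; 0, 0, 0; 0, 0, 0] : Matrix (Fin 3) (Fin 3) F)) ≠ 0 := by
  haveI : T2Space F := (isLocalField F).toT2Space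
  haveI : CompactSpace ↥(glInt 3 F) := isCompact_iff_compactSpace.1 (isCompact_glInt 3 F)
  intro h
  have htot := measure_add_measure_compl (μ := (κ.prod μN).map fun q : ↥(glInt 3 F) × ↥(unipotentRadicalGL F c) =>
      (((q.1 : GL (Fin 3) F)) : Matrix (Fin 3) (Fin 3) F) * ((((q.2 : GL (Fin 3) F)) : Matrix (Fin 3) (Fin 3) F) - 1) *
        ((((q.1 : GL (Fin 3) F))⁻¹ : GL (Fin 3) F) : Matrix (Fin 3) (Fin 3) F)) (measurableSet_orbit_nilpMin (F := F))
  rw [h, map_richardson_apply_compl_orbit_nilpMin κ μN hIJ, zero_add] at htot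
  exact map_richardson_ne_zero (F := F) (c := c) κ μN (Measure.measure_univ_eq_zero.1 htot.symm)

/-! ## §4  (R1d) MODULO THE REGULAR-ORBIT MEASURE: `J(𝒩)(𝔤𝔩₃(F)) = ℂδ₀ ⊕ ℂΛ_c ⊕ ℂΛ_J` with `Λ_c` the minimal Richardson measure -/

/-- **`J(𝒩)(𝔤𝔩₃(F)) = ℂδ₀ ⊕ ℂΛ_E ⊕ ℂΛ_J` WITH THE MINIMAL-ORBIT MEASURE DISCHARGED**: ★ (R1d) `gl3_nilpotentStructure_of_orbitMeasures` (K2E3-p20 (g5), p857363) with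
`Λ_E := Λ_c = φ_*(κ ⊗ μ_U)` for a monotone two-block `c` with non-empty box and Haar `κ`, `μ_U` — its four `Λ_E`-hypotheses are ★ part 1
`isFiniteMeasureOnCompacts_map_richardson` ∕ `map_conj_map_richardson_eq` ∕ `map_richardson_ne_zero` and §3 `map_richardson_apply_compl_orbit_nilpMin`; the
`Λ_E`-integral is rewritten as the Richardson orbital integral `∫_{GL₃(𝒪) × U_c} f(k (u − 1) k⁻¹)`.  What remains hypothesised is the REGULAR-orbit measure `Λ_J`
((R2-Borel)). [cite: HarishChandra1999AdmissibleDistributions, Thm. 3.9, Cor. 3.10 p. 10] [cite: BernsteinZelevinsky1976, §1.18] -/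
theorem gl3_nilpotentStructure_of_regularOrbitMeasure [MeasurableSpace F] [BorelSpace F] (hc : Monotone c) (hIJ : ∃ i j : Fin 3, c i = false ∧ c j = true)
    [IsHaarMeasure κ] [IsHaarMeasure μN]
    (ΛJ : Measure (Matrix (Fin 3) (Fin 3) F)) [IsFiniteMeasureOnCompacts ΛJ]
    (hΛJ : ∀ g : GL (Fin 3) F, ΛJ.map (fun Y : Matrix (Fin 3) (Fin 3) F => (g : Matrix (Fin 3) (Fin 3) F) * Y * ((g⁻¹ : GL (Fin 3) F) : Matrix (Fin 3) (Fin 3) F)) = ΛJ)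
    (hJ0 : ΛJ (MulAction.orbit (ConjAct (GL (Fin 3) F)) (!![0, 1, 0; 0, 0, 1; 0, 0, 0] : Matrix (Fin 3) (Fin 3) F))ᶜ = 0) (hJne : ΛJ ≠ 0)
    (T : (Matrix (Fin 3) (Fin 3) F → ℂ) → ℂ)
    (hT : (∀ f₁ f₂ : Matrix (Fin 3) (Fin 3) F → ℂ, IsLocSmooth f₁ → IsLocSmooth f₂ → T (f₁ + f₂) = T f₁ + T f₂) ∧
       (∀ (a : ℂ) (f : Matrix (Fin 3) (Fin 3) F → ℂ), IsLocSmooth f → T (a • f) = a * T f) ∧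
       (∀ (x : GL (Fin 3) F) (f : Matrix (Fin 3) (Fin 3) F → ℂ), IsLocSmooth f →
          T (fun X => f ((x : Matrix (Fin 3) (Fin 3) F) * X * ((x⁻¹ : GL (Fin 3) F) : Matrix (Fin 3) (Fin 3) F))) = T f) ∧
       (∀ f : Matrix (Fin 3) (Fin 3) F → ℂ, IsLocSmooth f → (∀ X ∈ tsupport f, ¬ IsNilpotent X) → T f = 0)) :
    ∃ a b c' : ℂ, ∀ f : Matrix (Fin 3) (Fin 3) F → ℂ, IsLocSmooth f →
      T f = a * f 0 + b * ∫ q : ↥(glInt 3 F) × ↥(unipotentRadicalGL F c), f ((((q.1 : GL (Fin 3) F)) : Matrix (Fin 3) (Fin 3) F) *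
        ((((q.2 : GL (Fin 3) F)) : Matrix (Fin 3) (Fin 3) F) - 1) * ((((q.1 : GL (Fin 3) F))⁻¹ : GL (Fin 3) F) : Matrix (Fin 3) (Fin 3) F)) ∂(κ.prod μN) +
        c' * ∫ X, f X ∂ΛJ := by
  haveI : T2Space F := (isLocalField F).toT2Space
  haveI : CompactSpace ↥(glInt 3 F) := isCompact_iff_compactSpace.1 (isCompact_glInt 3 F)
  haveI := sFinite_haar_unipotentRadicalGL (F := F) μN
  haveI := isFiniteMeasureOnCompacts_map_richardson (F := F) (c := c) κ μN
  obtain ⟨a, b, c', h⟩ := K2E3GL3NilpotentStructureOfOrbitMeasures.gl3_nilpotentStructure_of_orbitMeasures _ ΛJ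
    (map_conj_map_richardson_eq (F := F) (c := c) κ μN hc) hΛJ (map_richardson_apply_compl_orbit_nilpMin κ μN hIJ) (map_richardson_ne_zero (F := F) (c := c) κ μN)
    hJ0 hJne T hT
  refine ⟨a, b, c', fun f hf => ?_⟩
  rw [h f hf, integral_map (measurable_richardsonMap (F := F) (c := c)).aemeasurable hf.continuous.aestronglyMeasurable]

end Three

end Summit.HodgeConjecture.HodgeConjecture.Cruxes.H413.K2E3GL3MinimalRichardsonMeasure

end
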